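import Literature.NumberTheory.Transcendental.AyoubPeriodSeriesPiAlgebraic
import Mathlib.RingTheory.Algebraic.Integral
import Mathlib.FieldTheory.AlgebraicClosure

/-!
# `𝒪_{k-alg}(𝔻̄^∞)`: change of the coefficient field, and descent of the compact period conjecture

Proofs only (no new definitions, no new facts), on top of
`Literature/NumberTheory/Transcendental/AyoubPeriodSeries.lean` (objects of J. Ayoub, *La version
relative de la conjecture des périodes de Kontsevich–Zagier revisitée*, §1.1: `Oan σ = 𝒪_{k-alg}(𝔻̄^∞)`,
`intC`, `relAC`, `kSpan σ`) and `AyoubPeriodSeriesPiAlgebraic.lean` (`isAlgebraicOverRatFunc_iff_isAlgebraic`,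
`smul_mem_Oan`, `relAC_smul`).

## What is proved

* `IsAlgebraicOverRatFunc.of_comp`, `Oan_comp_subset` — pushing the coefficient field forward along a
  field map `τ : k →+* k'` with `σ = σ' ∘ τ`: `𝒪_{k-alg} ⊆ 𝒪_{k'-alg}`.
* `Oan_rat_subset` — `𝒪_{ℚ-alg}(𝔻̄^∞) ⊆ 𝒪_{k-alg}(𝔻̄^∞)` for every `k` of characteristic `0`.
* `Oan_subset_Oan_algebraicClosure` — if `σ(k)` consists of algebraic numbers, `𝒪_{k-alg} ⊆ 𝒪_{ℚ̄-alg}`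
  (`ℚ̄ = algebraicClosure ℚ ℂ`).
* `Oan_algebraicClosure_subset_Oan_rat` — **descent** `𝒪_{ℚ̄-alg}(𝔻̄^∞) ⊆ 𝒪_{ℚ-alg}(𝔻̄^∞)`: a power
  series algebraic over `ℚ̄(z)` is algebraic over `ℚ(z)` (Mathlib's
  `IsAlgebraic.restrictScalars_of_isIntegral` over the integral extension `ℚ[z] → ℚ̄[z]`). Hence all
  three algebras `𝒪_{ℚ-alg}`, `𝒪_{ℚ̄-alg}`, `𝒪_{k-alg}` (`σ(k)` algebraic) COINCIDE
  (`Oan_eq_Oan_rat_of_isAlgebraic`).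
* `typeAGeneration_forall_iff_rat`, `typeAGeneration_forall_iff_algebraicClosure` — consequently the
  three renderings of Ayoub's Conjecture 1.1 / Fresán's Conjecture 3.5 ("the kernel of
  `∫_{[0,1]^∞}` on `𝒪_{k-alg}(𝔻̄^∞)` is the `k`-span of the type-(a) elements
  `∂G/∂zᵢ − G|_{zᵢ=1} + G|_{zᵢ=0}`") — (i) for ALL `k` of characteristic `0` with algebraic image,
  (ii) for `k = ℚ` (Fresán's printed form, X-UPS 2024, Conj. 3.5, pp. 35–36), (iii) for `k = ℚ̄` — are
  EQUIVALENT. (The statements are written out as `Prop`s here; the named open conjecture lives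
  summit-side, `Summits/KontsevichZagierPeriods/KontsevichZagierPeriods/Theorems/TypeAGenerationConjecture.lean`,
  because unproven conjectures are obligations, not literature facts.)

Nothing is asserted about the conjecture itself. References: Ayoub 2015 (Ann. of Math. 181) Conj. 1.1,
Rem. 1.2; Fresán 2024 Conj. 3.5, Rem. 3.6–3.7.
-/

noncomputable section

open MvPowerSeries

namespace Literature.NumberTheory.Transcendental.AyoubRel

/-! ### Pushing the coefficient field forward -/

section Push

variable {k k' : Type} [Field k] [Field k'] (τ : k →+* k') (σ' : k' →+* ℂ)

/-- `polyToCSeries (σ' ∘ τ) = polyToCSeries σ' ∘ (map τ)` on `k[z]`. [folklore] -/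
theorem polyToCSeries_comp_map :
    (polyToCSeries σ').comp (MvPolynomial.map τ) = polyToCSeries (σ'.comp τ) := by
  refine RingHom.ext fun p => ?_
  simp [polyToCSeries, MvPolynomial.map_map]

/-- Algebraicity over `k(z)` along `σ' ∘ τ` implies algebraicity over `k'(z)` along `σ'` (push the
coefficients of the relation along `τ`). [cite: AyoubRelKZRevisited, §1.1] -/
theorem IsAlgebraicOverRatFunc.of_comp {F : CSeries} (h : IsAlgebraicOverRatFunc (σ'.comp τ) F) :
    IsAlgebraicOverRatFunc σ' F := by
  obtain ⟨P, hP, hPF⟩ := h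
  refine ⟨P.map (MvPolynomial.map τ), ?_, ?_⟩
  · exact (Polynomial.map_ne_zero_iff (MvPolynomial.map_injective τ τ.injective)).mpr hP
  · rw [Polynomial.eval₂_map, polyToCSeries_comp_map, hPF]

/-- `𝒪_{k-alg}(𝔻̄^∞) ⊆ 𝒪_{k'-alg}(𝔻̄^∞)` along `τ : k → k'` with `σ = σ' ∘ τ`. [cite: AyoubRelKZRevisited, §1.1] -/
theorem Oan_comp_subset : Oan (σ'.comp τ) ⊆ Oan σ' :=
  fun _ ⟨hdep, hrad, halg⟩ => ⟨hdep, hrad, halg.of_comp τ σ'⟩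

/-- A `k`-combination along `σ' ∘ τ` is a `k'`-combination along `σ'`. [folklore] -/
theorem kSpan_comp_subset {M : Type*} [AddCommGroup M] [Module ℂ M] (S : Set M) :
    kSpan (σ'.comp τ) S ⊆ kSpan σ' S := by
  rintro x ⟨n, c, s, hs, rfl⟩
  exact ⟨n, fun j => τ (c j), s, hs, rfl⟩

end Push

/-! ### `k = ℚ` below every `k`, and every `k` with algebraic image below `ℚ̄` -/

section Rat

variable {k : Type} [Field k] (σ : k →+* ℂ)

/-- The embedding `ℚ → ℂ` factors through every `σ : k →+* ℂ`. [folklore] -/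
theorem algebraMap_rat_eq_comp [CharZero k] : algebraMap ℚ ℂ = σ.comp (algebraMap ℚ k) :=
  Subsingleton.elim _ _

/-- `𝒪_{ℚ-alg}(𝔻̄^∞) ⊆ 𝒪_{k-alg}(𝔻̄^∞)` for every field `k` of characteristic `0` with a complex
embedding `σ`. [cite: AyoubRelKZRevisited, §1.1] -/
theorem Oan_rat_subset [CharZero k] : Oan (algebraMap ℚ ℂ) ⊆ Oan σ := by
  rw [algebraMap_rat_eq_comp σ]
  exact Oan_comp_subset (algebraMap ℚ k) σ

/-- A `ℚ`-combination is a `k`-combination along any `σ`. [folklore] -/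
theorem kSpan_rat_subset [CharZero k] {M : Type*} [AddCommGroup M] [Module ℂ M] (S : Set M) :
    kSpan (algebraMap ℚ ℂ) S ⊆ kSpan σ S := by
  rw [algebraMap_rat_eq_comp σ]
  exact kSpan_comp_subset (algebraMap ℚ k) σ S

/-- If `σ(k)` consists of algebraic numbers, `σ` factors through `ℚ̄ = algebraicClosure ℚ ℂ`.
[folklore] -/
theorem exists_comp_eq_of_isAlgebraic (halg : ∀ c : k, IsAlgebraic ℚ (σ c)) :
    ∃ τ : k →+* algebraicClosure ℚ ℂ, σ = (algebraMap (algebraicClosure ℚ ℂ) ℂ).comp τ := by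
  refine ⟨σ.codRestrict (algebraicClosure ℚ ℂ).toSubalgebra.toSubring
    (fun c => mem_algebraicClosure_iff.mpr (halg c)), ?_⟩
  refine RingHom.ext fun c => ?_
  rfl

/-- `𝒪_{k-alg}(𝔻̄^∞) ⊆ 𝒪_{ℚ̄-alg}(𝔻̄^∞)` when `σ(k)` consists of algebraic numbers.
[cite: AyoubRelKZRevisited, §1.1] -/
theorem Oan_subset_Oan_algebraicClosure (halg : ∀ c : k, IsAlgebraic ℚ (σ c)) :
    Oan σ ⊆ Oan (algebraMap (algebraicClosure ℚ ℂ) ℂ) := by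
  obtain ⟨τ, hτ⟩ := exists_comp_eq_of_isAlgebraic σ halg
  rw [hτ]
  exact Oan_comp_subset τ _

end Rat

/-! ### Descent from `ℚ̄` to `ℚ` -/

section Descent

/-- `ℚ̄[z]` is an integral extension of `ℚ[z]` (coefficientwise: every element of `ℚ̄` is integral
over `ℚ`, the variables are their own images). [folklore] -/
theorem isIntegral_map_algebraicClosure :
    (MvPolynomial.map (σ := ℕ) (algebraMap ℚ (algebraicClosure ℚ ℂ))).IsIntegral := by
  set θ := MvPolynomial.map (σ := ℕ) (algebraMap ℚ (algebraicClosure ℚ ℂ)) with hθ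
  letI : Algebra (MvPolynomial ℕ ℚ) (MvPolynomial ℕ (algebraicClosure ℚ ℂ)) := θ.toAlgebra
  have hC : ∀ d : algebraicClosure ℚ ℂ, IsIntegral (MvPolynomial ℕ ℚ)
      (MvPolynomial.C d : MvPolynomial ℕ (algebraicClosure ℚ ℂ)) := fun d => by
    -- a monic relation of `d` over `ℚ`, read in `ℚ̄` (from `d ∈ algebraicClosure ℚ ℂ`, via `ℂ`)
    obtain ⟨p, hpm, hpd⟩ : ∃ p : Polynomial ℚ, p.Monic ∧
        Polynomial.eval₂ (algebraMap ℚ (algebraicClosure ℚ ℂ)) d p = 0 := by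
      obtain ⟨p, hp, hpd⟩ := mem_algebraicClosure_iff.1 d.2
      refine ⟨p * Polynomial.C (p.leadingCoeff)⁻¹, Polynomial.monic_mul_leadingCoeff_inv hp, ?_⟩
      apply (algebraMap (algebraicClosure ℚ ℂ) ℂ).injective
      rw [Polynomial.hom_eval₂, map_zero,
        show (algebraMap (algebraicClosure ℚ ℂ) ℂ).comp (algebraMap ℚ (algebraicClosure ℚ ℂ)) =
          algebraMap ℚ ℂ from Subsingleton.elim _ _, Polynomial.eval₂_mul]
      have e : Polynomial.eval₂ (algebraMap ℚ ℂ) (algebraMap (algebraicClosure ℚ ℂ) ℂ d) p = 0 := by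
        convert hpd using 1
        rw [Polynomial.aeval_def]
        congr 1
      rw [e, zero_mul]
    refine ⟨p.map (MvPolynomial.C : ℚ →+* MvPolynomial ℕ ℚ), hpm.map _, ?_⟩
    rw [Polynomial.eval₂_map]
    have hcomp : (algebraMap (MvPolynomial ℕ ℚ) (MvPolynomial ℕ (algebraicClosure ℚ ℂ))).comp
        (MvPolynomial.C : ℚ →+* MvPolynomial ℕ ℚ) =
        (MvPolynomial.C : algebraicClosure ℚ ℂ →+* MvPolynomial ℕ (algebraicClosure ℚ ℂ)).comp
          (algebraMap ℚ (algebraicClosure ℚ ℂ)) := by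
      refine RingHom.ext fun a => ?_
      show θ (MvPolynomial.C a) = _
      simp [hθ, MvPolynomial.map_C]
    rw [hcomp, ← Polynomial.hom_eval₂, hpd, map_zero]
  have hX : ∀ i : ℕ, IsIntegral (MvPolynomial ℕ ℚ)
      (MvPolynomial.X i : MvPolynomial ℕ (algebraicClosure ℚ ℂ)) := fun i => by
    have : (MvPolynomial.X i : MvPolynomial ℕ (algebraicClosure ℚ ℂ)) =
        algebraMap (MvPolynomial ℕ ℚ) _ (MvPolynomial.X i) := by
      show _ = θ (MvPolynomial.X i)
      simp [hθ, MvPolynomial.map_X]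
    rw [this]
    exact isIntegral_algebraMap
  intro p
  show IsIntegral (MvPolynomial ℕ ℚ) p
  induction p using MvPolynomial.induction_on with
  | C d => exact hC d
  | add p₁ p₂ h₁ h₂ => exact h₁.add h₂
  | mul_X p i hp => exact hp.mul (hX i)

/-- **Descent**: a power series algebraic over `ℚ̄(z)` is algebraic over `ℚ(z)`
(`IsAlgebraic.restrictScalars_of_isIntegral` through the integral extension `ℚ[z] → ℚ̄[z]`).
[cite: AyoubRelKZRevisited, §1.1] -/
theorem IsAlgebraicOverRatFunc.rat_of_algebraicClosure {F : CSeries}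
    (h : IsAlgebraicOverRatFunc (algebraMap (algebraicClosure ℚ ℂ) ℂ) F) :
    IsAlgebraicOverRatFunc (algebraMap ℚ ℂ) F := by
  letI algSA : Algebra (MvPolynomial ℕ (algebraicClosure ℚ ℂ)) CSeries :=
    (polyToCSeries (algebraMap (algebraicClosure ℚ ℂ) ℂ)).toAlgebra
  letI algRS : Algebra (MvPolynomial ℕ ℚ) (MvPolynomial ℕ (algebraicClosure ℚ ℂ)) :=
    (MvPolynomial.map (σ := ℕ) (algebraMap ℚ (algebraicClosure ℚ ℂ))).toAlgebra
  letI algRA : Algebra (MvPolynomial ℕ ℚ) CSeries := (polyToCSeries (algebraMap ℚ ℂ)).toAlgebra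
  haveI : IsScalarTower (MvPolynomial ℕ ℚ) (MvPolynomial ℕ (algebraicClosure ℚ ℂ)) CSeries := by
    refine IsScalarTower.of_algebraMap_eq' ?_
    show polyToCSeries (algebraMap ℚ ℂ) =
      (polyToCSeries (algebraMap (algebraicClosure ℚ ℂ) ℂ)).comp
        (MvPolynomial.map (algebraMap ℚ (algebraicClosure ℚ ℂ)))
    rw [polyToCSeries_comp_map]
    congr 1
  haveI : Algebra.IsIntegral (MvPolynomial ℕ ℚ) (MvPolynomial ℕ (algebraicClosure ℚ ℂ)) :=
    ⟨isIntegral_map_algebraicClosure⟩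
  have halg : IsAlgebraic (MvPolynomial ℕ (algebraicClosure ℚ ℂ)) F :=
    (isAlgebraicOverRatFunc_iff_isAlgebraic _ F).mp h
  exact (isAlgebraicOverRatFunc_iff_isAlgebraic _ F).mpr
    (halg.restrictScalars_of_isIntegral (MvPolynomial ℕ ℚ))

/-- **`𝒪_{ℚ̄-alg}(𝔻̄^∞) ⊆ 𝒪_{ℚ-alg}(𝔻̄^∞)`** (hence `=`, with `Oan_rat_subset`): Fresán's
`𝒪_{ℚ-alg}` (X-UPS 2024, p. 35: "algébriques sur `ℚ(z₁, …, zₙ)`") and Ayoub's `𝒪_{ℚ̄-alg}` are the same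
algebra. [cite: Fresan2024, Conj. 3.5] -/
theorem Oan_algebraicClosure_subset_Oan_rat :
    Oan (algebraMap (algebraicClosure ℚ ℂ) ℂ) ⊆ Oan (algebraMap ℚ ℂ) :=
  fun _ ⟨hdep, hrad, halg⟩ => ⟨hdep, hrad, halg.rat_of_algebraicClosure⟩

/-- `𝒪_{ℚ̄-alg}(𝔻̄^∞) = 𝒪_{ℚ-alg}(𝔻̄^∞)`. [cite: Fresan2024, Conj. 3.5] -/
theorem Oan_algebraicClosure_eq_Oan_rat :
    Oan (algebraMap (algebraicClosure ℚ ℂ) ℂ) = Oan (algebraMap ℚ ℂ) :=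
  Set.Subset.antisymm Oan_algebraicClosure_subset_Oan_rat (Oan_rat_subset _)

/-- For every `k` of characteristic `0` whose image `σ(k) ⊆ ℂ` is algebraic,
`𝒪_{k-alg}(𝔻̄^∞) = 𝒪_{ℚ-alg}(𝔻̄^∞)`. [cite: Fresan2024, Conj. 3.5] -/
theorem Oan_eq_Oan_rat_of_isAlgebraic {k : Type} [Field k] [CharZero k] (σ : k →+* ℂ)
    (halg : ∀ c : k, IsAlgebraic ℚ (σ c)) : Oan σ = Oan (algebraMap ℚ ℂ) :=
  Set.Subset.antisymm
    ((Oan_subset_Oan_algebraicClosure σ halg).trans Oan_algebraicClosure_subset_Oan_rat)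
    (Oan_rat_subset σ)

end Descent

/-! ### The three renderings of the compact period conjecture are equivalent -/

section TypeA

/-- **Fresán's form (`k = ℚ`) implies the form for every `k` with algebraic image.** If the kernel
of `∫` on `𝒪_{ℚ-alg}` is the `ℚ`-span of the type-(a) elements, then for every `σ : k →+* ℂ` with
algebraic image the kernel of `∫` on `𝒪_{k-alg}` is the `k`-span of the type-(a) elements of
`𝒪_{k-alg}`: `𝒪_{k-alg} = 𝒪_{ℚ-alg}` (`Oan_eq_Oan_rat_of_isAlgebraic`) and a `ℚ`-combination is a
`k`-combination. [cite: Fresan2024, Conj. 3.5] -/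
theorem typeAGeneration_of_rat
    (h : ∀ F ∈ Oan (algebraMap ℚ ℂ), intC F = 0 →
      F ∈ kSpan (algebraMap ℚ ℂ) {x : CSeries | ∃ G ∈ Oan (algebraMap ℚ ℂ), ∃ i : ℕ, x = relAC i G})
    (k : Type) [Field k] [CharZero k] (σ : k →+* ℂ) (halg : ∀ c : k, IsAlgebraic ℚ (σ c)) :
    ∀ F ∈ Oan σ, intC F = 0 →
      F ∈ kSpan σ {x : CSeries | ∃ G ∈ Oan σ, ∃ i : ℕ, x = relAC i G} := by
  intro F hF hF0
  rw [Oan_eq_Oan_rat_of_isAlgebraic σ halg] at hF ⊢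
  exact kSpan_rat_subset σ _ (h F hF hF0)

/-- **Equivalence (i) ⇔ (ii)**: "type-(a) generation for every field of characteristic `0` with
algebraic image" (the summit-side `TypeAGenerationConjecture`, written out) is equivalent to
Fresán's printed Conjecture 3.5 (`k = ℚ`). [cite: Fresan2024, Conj. 3.5] -/
theorem typeAGeneration_forall_iff_rat :
    (∀ (k : Type) [Field k] [CharZero k] (σ : k →+* ℂ), (∀ c : k, IsAlgebraic ℚ (σ c)) →
      ∀ F ∈ Oan σ, intC F = 0 →
        F ∈ kSpan σ {x : CSeries | ∃ G ∈ Oan σ, ∃ i : ℕ, x = relAC i G}) ↔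
    (∀ F ∈ Oan (algebraMap ℚ ℂ), intC F = 0 →
      F ∈ kSpan (algebraMap ℚ ℂ)
        {x : CSeries | ∃ G ∈ Oan (algebraMap ℚ ℂ), ∃ i : ℕ, x = relAC i G}) :=
  ⟨fun h => h ℚ (algebraMap ℚ ℂ) fun c => isAlgebraic_algebraMap c,
    fun h k _ _ σ halg => typeAGeneration_of_rat h k σ halg⟩

/-- **The `ℚ̄`-form implies Fresán's form.** If the kernel of `∫` on `𝒪_{ℚ̄-alg}` is the `ℚ̄`-span of
the type-(a) elements, then the kernel on `𝒪_{ℚ-alg}` (the same algebra) is their `ℚ`-span: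
`c • (∂G/∂zᵢ − G|₁ + G|₀) = ∂(cG)/∂zᵢ − (cG)|₁ + (cG)|₀` (`relAC_smul`) and `cG ∈ 𝒪_{ℚ̄-alg} = 𝒪_{ℚ-alg}`
for `c ∈ ℚ̄` (`smul_mem_Oan`), so all coefficients become `1`. [cite: Fresan2024, Conj. 3.5] -/
theorem typeAGeneration_rat_of_algebraicClosure
    (h : ∀ F ∈ Oan (algebraMap (algebraicClosure ℚ ℂ) ℂ), intC F = 0 →
      F ∈ kSpan (algebraMap (algebraicClosure ℚ ℂ) ℂ)
        {x : CSeries | ∃ G ∈ Oan (algebraMap (algebraicClosure ℚ ℂ) ℂ), ∃ i : ℕ, x = relAC i G}) :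
    ∀ F ∈ Oan (algebraMap ℚ ℂ), intC F = 0 →
      F ∈ kSpan (algebraMap ℚ ℂ)
        {x : CSeries | ∃ G ∈ Oan (algebraMap ℚ ℂ), ∃ i : ℕ, x = relAC i G} := by
  intro F hF hF0
  rw [← Oan_algebraicClosure_eq_Oan_rat] at hF
  obtain ⟨n, c, s, hs, rfl⟩ := h F hF hF0
  choose G hG i hsi using hs
  refine ⟨n, fun _ => 1, fun j => relAC (i j) ((algebraMap (algebraicClosure ℚ ℂ) ℂ (c j)) • G j),
    fun j => ⟨_, ?_, i j, rfl⟩, ?_⟩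
  · rw [← Oan_algebraicClosure_eq_Oan_rat]
    refine smul_mem_Oan _ ?_ (hG j)
    obtain ⟨p, hp, hpc⟩ := (mem_algebraicClosure_iff.1 (c j).2 :
      IsAlgebraic ℚ (algebraMap (algebraicClosure ℚ ℂ) ℂ (c j)))
    exact ⟨p.map (algebraMap ℚ (algebraicClosure ℚ ℂ)),
      (Polynomial.map_ne_zero_iff (algebraMap ℚ _).injective).mpr hp, by
        rw [Polynomial.eval₂_map]; exact hpc⟩
  · refine Finset.sum_congr rfl fun j _ => ?_
    show _ = (algebraMap ℚ ℂ 1) •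
      relAC (i j) ((algebraMap (algebraicClosure ℚ ℂ) ℂ (c j)) • G j)
    rw [map_one, one_smul, relAC_smul, hsi j]

/-- **Equivalence (i) ⇔ (iii)**: "type-(a) generation for every field of characteristic `0` with
algebraic image" is equivalent to its single instance `k = ℚ̄ = algebraicClosure ℚ ℂ` (the form
registered as `stub_typeAGeneration`'s use in the summit-side line `Sketch` of crux `StokesGeneration`).
[cite: Ayoub2015, Conj. 1.1] -/
theorem typeAGeneration_forall_iff_algebraicClosure :
    (∀ (k : Type) [Field k] [CharZero k] (σ : k →+* ℂ), (∀ c : k, IsAlgebraic ℚ (σ c)) →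
      ∀ F ∈ Oan σ, intC F = 0 →
        F ∈ kSpan σ {x : CSeries | ∃ G ∈ Oan σ, ∃ i : ℕ, x = relAC i G}) ↔
    (∀ F ∈ Oan (algebraMap (algebraicClosure ℚ ℂ) ℂ), intC F = 0 →
      F ∈ kSpan (algebraMap (algebraicClosure ℚ ℂ) ℂ)
        {x : CSeries | ∃ G ∈ Oan (algebraMap (algebraicClosure ℚ ℂ) ℂ), ∃ i : ℕ, x = relAC i G}) :=
  ⟨fun h => h _ _ fun c => (mem_algebraicClosure_iff.1 c.2 :
      IsAlgebraic ℚ (algebraMap (algebraicClosure ℚ ℂ) ℂ c)),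
    fun h => typeAGeneration_forall_iff_rat.mpr (typeAGeneration_rat_of_algebraicClosure h)⟩

end TypeA

end Literature.NumberTheory.Transcendental.AyoubRel
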